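import Summits.CriticalPhenomena.PercolationContinuityZ3.Theorems.PercNearOneGluingNoHeavyQuantFarSunRow
import Mathlib.Data.Prod.Lex
import Mathlib.Data.Finset.Sort
import HarnessLib

/-!
# QUANT lane R8, front "FAR beyond trees" — RINGS WITHOUT AN ENUMERATION: the `SunFAR` bridge from an attachment map

builds on p205010 (kernel theorem, internal audit signed; external expert review pending)

Support file (`--supports stmt-CriticalPhenomena-4575`), seat `prim-quant-p1` (gen 18); memo
`run/shared/lean/prim/quant/prim-quant-p1-g18/FOR-LEAD-UNICYCLIC-TREES.md` §3, `FOR-PROVERS-FLATTENING-FC.md` §2 (end state of the flattening, F-C (iv)).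
Standard axioms; no sorries; no definitions.

prim-cert-1's `HairyCycle.farRelayRow_ring_of_sunFAR` needs the relays enumerated as `tip 0, …, tip (K−1)` with MONOTONE bases (`IsHairyCycleD`).
The flattening algorithm ends with an unordered description: a cycle `c_0 = o, …, c_{L−1}` and a relay set `A`, each relay `a` attached to a cycle index
`att a < L` — either `a = c_{att a}` (relay on the cycle) or `a` is a pendant tip whose only positive pair is `s(c_{att a}, a)`.  Sorting `A` by
`(att a, a)` lexicographically supplies the enumeration:

* `HairyCycle.exists_isHairyCycleD_of_att` — such data `K = |A|`, `base`, `tip` with `IsHairyCycleD L cyc K base tip`, `(range K).image tip = A`,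
  `base k = att (tip k)`;
* **`HairyCycle.farRelayRow_ring_of_sunFAR_att`** — `SunFAR |A| j` ⟹ the body of `Quant.FarRelayRow` at layer `j` for every weight function supported on
  the cycle pairs and the pairs `s(c_{att a}, a)`, relay set `A` (`|A| ≥ 2`), observer `c_0`.
[cite: KozmaNitzan2024, Conjecture 3 (p. 15)] (the rows served); [cite: Grimmett1999, §1.3 p. 10]; bookkeeping [this work].
-/

noncomputable section

namespace Summit.CriticalPhenomena.PercolationContinuityZ3.Theorems.HairyCycle

open Finset MeasureTheory
open Literature.Probability.Percolation Literature.Probability.LatticeModels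
open scoped Classical

variable {n : ℕ} {L : ℕ} {cyc : ℕ → Fin n}

/-- **Sorting the relays by attachment index** yields `IsHairyCycleD` data enumerating exactly `A`. [this work] -/
theorem exists_isHairyCycleD_of_att (hL : 3 ≤ L) (hcyc : ∀ i j, i < L → j < L → cyc i = cyc j → i = j)
    (A : Finset (Fin n)) (hK : 2 ≤ A.card) (att : Fin n → ℕ) (hatt : ∀ a ∈ A, att a < L)
    (hcycrel : ∀ a ∈ A, ∀ i, i < L → a = cyc i → att a = i) :
    ∃ (base : ℕ → ℕ) (tip : ℕ → Fin n), IsHairyCycleD L cyc A.card base tip ∧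
      (Finset.range A.card).image tip = A ∧ (∀ k, k < A.card → base k = att (tip k)) := by
  -- the sorted list of pairs `(att a, a)`
  set f : Fin n → ℕ ×ₗ Fin n := fun a => toLex (att a, a) with hf
  have hfinj : Function.Injective f := by
    intro a b h
    have := congrArg (fun x => (ofLex x).2) h
    simpa [hf] using this
  have hlen : ((A.image f).sort (· ≤ ·)).length = A.card := by
    rw [Finset.length_sort, Finset.card_image_of_injective _ hfinj]
  have hA0 : A.Nonempty := Finset.card_pos.1 (by omega)
  obtain ⟨a₀, ha₀⟩ := hA0
  -- the k-th pair (junk beyond the length)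
  set nth : ℕ → ℕ × Fin n := fun k =>
    if h : k < ((A.image f).sort (· ≤ ·)).length then ofLex (((A.image f).sort (· ≤ ·)).get ⟨k, h⟩) else (0, a₀) with hnth
  have hnth_of_lt : ∀ k (hk : k < ((A.image f).sort (· ≤ ·)).length), nth k = ofLex (((A.image f).sort (· ≤ ·)).get ⟨k, hk⟩) := by
    intro k hk; simp only [hnth, dif_pos hk]
  have hnth_mem : ∀ k, k < A.card → ∃ a ∈ A, nth k = (att a, a) := by
    intro k hk
    have hk' : k < ((A.image f).sort (· ≤ ·)).length := by rw [hlen]; exact hk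
    have hmem : ((A.image f).sort (· ≤ ·)).get ⟨k, hk'⟩ ∈ A.image f := (Finset.mem_sort _).1 (List.get_mem _ _)
    obtain ⟨a, ha, hfa⟩ := Finset.mem_image.1 hmem
    refine ⟨a, ha, ?_⟩
    rw [hnth_of_lt k hk', ← hfa]
    rfl
  refine ⟨fun k => (nth k).1, fun k => (nth k).2, ?_, ?_, ?_⟩
  · -- `IsHairyCycleD`
    refine ⟨hL, hK, hcyc, ?_, ?_, ?_, ?_⟩
    · -- bases on the cycle
      intro k hk
      obtain ⟨a, ha, he⟩ := hnth_mem k hk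
      simp only [he]; exact hatt a ha
    · -- tips injective
      intro k k' hk hk' heq
      have hkL : k < ((A.image f).sort (· ≤ ·)).length := by rw [hlen]; exact hk
      have hkL' : k' < ((A.image f).sort (· ≤ ·)).length := by rw [hlen]; exact hk'
      obtain ⟨a, ha, he⟩ := hnth_mem k hk
      obtain ⟨a', ha', he'⟩ := hnth_mem k' hk'
      have haa' : a = a' := by
        have h1 : (nth k).2 = a := by rw [he]
        have h2 : (nth k').2 = a' := by rw [he']
        rw [← h1, ← h2]; exact heq
      subst haa'
      -- the same pair occurs at positions `k` and `k'` of a duplicate-free list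
      have hget : ((A.image f).sort (· ≤ ·)).get ⟨k, hkL⟩ = ((A.image f).sort (· ≤ ·)).get ⟨k', hkL'⟩ := by
        have e1 : ofLex (((A.image f).sort (· ≤ ·)).get ⟨k, hkL⟩) = (att a, a) := by rw [← hnth_of_lt k hkL]; exact he
        have e2 : ofLex (((A.image f).sort (· ≤ ·)).get ⟨k', hkL'⟩) = (att a, a) := by rw [← hnth_of_lt k' hkL']; exact he'
        exact ofLex.injective (e1.trans e2.symm)
      have hnd : ((A.image f).sort (· ≤ ·)).Nodup := Finset.sort_nodup _ _
      have := (List.Nodup.get_inj_iff hnd).1 hget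
      exact congrArg Fin.val this
    · -- a tip on the cycle is its own base
      intro k i hk hi heq
      obtain ⟨a, ha, he⟩ := hnth_mem k hk
      have hta : (nth k).2 = a := by rw [he]
      have hba : (nth k).1 = att a := by rw [he]
      rw [hta] at heq
      rw [hba]
      exact (hcycrel a ha i hi heq).symm
    · -- bases monotone (the list is sorted lexicographically)
      intro k k' hkk' hk'
      have hk : k < A.card := lt_of_le_of_lt hkk' hk'
      have hkL : k < ((A.image f).sort (· ≤ ·)).length := by rw [hlen]; exact hk
      have hkL' : k' < ((A.image f).sort (· ≤ ·)).length := by rw [hlen]; exact hk'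
      have hsorted : ((A.image f).sort (· ≤ ·)).Pairwise (· ≤ ·) := Finset.pairwise_sort _ _
      have hle : ((A.image f).sort (· ≤ ·)).get ⟨k, hkL⟩ ≤ ((A.image f).sort (· ≤ ·)).get ⟨k', hkL'⟩ :=
        hsorted.rel_get_of_le (show (⟨k, hkL⟩ : Fin ((A.image f).sort (· ≤ ·)).length) ≤ ⟨k', hkL'⟩ from hkk')
      rw [hnth_of_lt k hkL, hnth_of_lt k' hkL']
      have key := (Prod.Lex.toLex_le_toLex' (x := ofLex (((A.image f).sort (· ≤ ·)).get ⟨k, hkL⟩))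
        (y := ofLex (((A.image f).sort (· ≤ ·)).get ⟨k', hkL'⟩))).1 (by simpa using hle)
      exact key.1
  · -- the enumeration is onto `A`
    ext a
    simp only [Finset.mem_image, Finset.mem_range]
    constructor
    · rintro ⟨k, hk, rfl⟩
      obtain ⟨b, hb, he⟩ := hnth_mem k hk
      simp only [he]; exact hb
    · intro ha
      have hmem : f a ∈ (A.image f).sort (· ≤ ·) := (Finset.mem_sort _).2 (Finset.mem_image_of_mem f ha)
      obtain ⟨⟨k, hk⟩, hget⟩ := List.mem_iff_get.1 hmem
      refine ⟨k, by rw [← hlen]; exact hk, ?_⟩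
      rw [hnth_of_lt k hk, hget]
      rfl
  · intro k hk
    obtain ⟨a, ha, he⟩ := hnth_mem k hk
    simp only [he]

/-- **`SunFAR |A| j` ⟹ the body of `Quant.FarRelayRow` at layer `j` on every RING given by an attachment map.**  Cycle `c_0 = o, …, c_{L−1}`
(injective, `L ≥ 3`); relays `A` (`|A| ≥ 2`), each `a ∈ A` attached at `att a < L`, a relay equal to a cycle vertex `c_i` having `att a = i`; weights
supported on the cycle pairs `cycE` and the pairs `s(c_{att a}, a)`, `a ∈ A`.  Then `2j < Σ_{a∈A} P(c_0 ↔ a)` and `P(c_0 ↮ a) ≤ t` on `A` imply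
`P(#{a ∈ A : c_0 ↔ a} ≤ j) ≤ t`. [this work] -/
theorem farRelayRow_ring_of_sunFAR_att (hL : 3 ≤ L) (hcyc : ∀ i j, i < L → j < L → cyc i = cyc j → i = j)
    (A : Finset (Fin n)) (hK : 2 ≤ A.card) (att : Fin n → ℕ) (hatt : ∀ a ∈ A, att a < L)
    (hcycrel : ∀ a ∈ A, ∀ i, i < L → a = cyc i → att a = i) {j : ℕ} (hS : SunFAR A.card j)
    (w : Sym2 (Fin n) → unitInterval)
    (hsupp : ∀ e : Sym2 (Fin n), ¬ e.IsDiag → w e ≠ 0 →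
      (∃ i, i < L ∧ e = cycE L cyc i) ∨ (∃ a ∈ A, e = s(cyc (att a), a)))
    (t : ℝ) (hEN : (2 * j : ℝ) < ∑ a ∈ A, (prodBernoulli w).real (openConn (cyc 0) a))
    (hcut : ∀ a ∈ A, (prodBernoulli w).real (openConn (cyc 0) a)ᶜ ≤ t) :
    (prodBernoulli w).real {ω : BondConfig (Fin n) | (A.filter fun a => ω ∈ openConn (cyc 0) a).card ≤ j} ≤ t := by
  obtain ⟨base, tip, H, himg, hbase⟩ := exists_isHairyCycleD_of_att hL hcyc A hK att hatt hcycrel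
  have hsupp' : ∀ e : Sym2 (Fin n), ¬ e.IsDiag → w e ≠ 0 →
      (∃ i, i < L ∧ e = cycE L cyc i) ∨ (∃ k, k < A.card ∧ e = hairE cyc base tip k) := by
    intro e hd hne
    rcases hsupp e hd hne with h | ⟨a, ha, he⟩
    · exact Or.inl h
    · right
      have ha' : a ∈ (Finset.range A.card).image tip := by rw [himg]; exact ha
      obtain ⟨k, hk, rfl⟩ := Finset.mem_image.1 ha'
      rw [Finset.mem_range] at hk
      refine ⟨k, hk, ?_⟩
      rw [he]; unfold hairE; rw [hbase k hk]
  have h := farRelayRow_ring_of_sunFAR H hS w hsupp' t (by rw [himg]; exact hEN) (by rw [himg]; exact hcut)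
  rw [himg] at h
  exact h

end Summit.CriticalPhenomena.PercolationContinuityZ3.Theorems.HairyCycle
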